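import Literature.NumberTheory.Sieve.LargestPrimeFactorCubicChebyshev
import Literature.NumberTheory.Sieve.LargestPrimeFactorCubicTBound
import HarnessLib

/-!
# Heath-Brown 2001, Theorem 1 from sieve weights: Lemma 3 with Irving's counting, proved

Fifth proved layer of this seat (`…Local`, `…Mertens`, `…SmoothSum`, `…Chebyshev`) under the
named fact `HeathBrown2001_largestPrimeFactor_cubic` (`LargestPrimeFactorCubic.lean`; D. R.
Heath-Brown, *The largest prime factor of `X³ + 2`*, Proc. London Math. Soc. (3) 82 (2001)
554–596, Thm. 1).

Heath-Brown's §2 reduces Theorem 1 to a lower bound for the sieve-weighted divisor count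
`S = ∑_K ∑_{L ∈ 𝓛(K)} (∑_{d ∣ (Q, N(L))} λ_d) #𝒜_{KL} = X S₀ + S₁` (p. 561): by (2.7),
`S ≤ ∑_n W(n)` with `W(n) = #{(K, L) : K ∈ 𝒦, L ∈ 𝓛(K), (N(L), Q) = 1, KL ∣ n + ∛2}`, every `n`
with `W(n) > 0` lies in `𝒜^{(1)}` (p. 560: `log^{(1)}(n³ + 2) ≥ log N(KL) ≥ (1 + δ) log X`), and
"`n + ∛2` can have at most `[3δ⁻¹]` prime ideal factors `P` … with `N(P) ≥ X^δ` … at most `[δ⁻¹]`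
possible choices for `K`, and at most `2^{[3/δ]}` possible choices for `L`" — whence **Lemma 3**:
"Suppose that `S₁ = o(X)`. Then any constant `α < δ 2^{−[3/δ]} S₀` will be acceptable in Lemma 2."
Heath-Brown remarks (p. 562) that "with a little extra work, the exponential dependence on `δ⁻¹`
can be replaced by a polynomial one"; A. J. Irving (*The largest prime factor of `X³ + 2`*, Acta
Arith. 171 (2015), §§2–3) did exactly this: with `Ω_δ(n) =` the number of prime factors `≥ X^δ`
of `n³ + 2` counted with multiplicity one has `W(n) ≤ min(Ω_δ(n), [1/δ]) 2^{Ω_δ(n)}`, and the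
`n` with `Ω_δ(n) > H` are few (`T(h, δ) ≤ (c(h, δ) + o(1)) X`, his Lemma 3.2 — PROVED in the tree,
`Irving2015.irving_lemma_3_2`, file `LargestPrimeFactorCubicTBound.lean`, together with the
truncation inequality `Irving2015.sum_weight_le`, file `LargestPrimeFactorCubicProofs.lean`).

This file PROVES the resulting form of Lemma 3 with Heath-Brown's `δ = 1/321` (forced by his
Lemma 5) and Irving's truncation at `H = 400`:

* `HeathBrown2001_largestPrimeFactor_cubic_of_weights` — if for all large `X` there are weights
  `W(n) ∈ ℕ` on `(X, 2X]` with (i) `W(n) > 0 ⇒ ∑_{p ≤ 3X} v_p(n³+2) log p ≥ (1 + 1/321) log X`,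
  (ii) `W(n) ≤ min(Ω(n), 321) · 2^{Ω(n)}`, `Ω(n) = Ω_{1/321}(n)`, and (iii) `∑_n W(n) ≥ c X` for
  some constant `c ≥ 10⁻⁹⁰`, then `HeathBrown2001_largestPrimeFactor_cubic` holds;
* `HeathBrown2001_largestPrimeFactor_cubic_of_divisorWeights` — the same with (i) replaced by
  Heath-Brown's own sufficient condition "`n³ + 2` has a divisor `d` (`= N(KL)`) with
  `X^{1+1/321} < d` all of whose prime factors are `≤ 3X`" (p. 560).

Proof: `Ω(n) ≤ 963` for `X ≥ 10^{321}` (`Irving2015.card_largePrimeFactors_lt`);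
`Irving2015.sum_weight_le` with `H = 400`, `M = 321`, `B = 963`; the tail
`∑_{400 < h ≤ 963} min(h, 321) 2^h T(h) ≤ 10⁻⁹² X + o(X)` from Lemma 3.2 and the numerical bound
`tail_numeric` (each of the 563 terms `min(h,321) 2^h c(h, 1/321)` is at most
`1284 · (228/25)^{133}/133!`, because `0 ≤ log((964 − k)/(h − k + 1)) ≤ 57/50`, `2^h ≤ 4 · 8^k`
and `(8 · 57/50)^k/k!` decreases for `k ≥ 133`); hence `#{n : W(n) > 0} ≥ α X` with
`α = (c − 2·10⁻⁹²)/(321 · 2^{400})`, and `αδ/2 > 10⁻³⁰³` amply (`2^{400} < 10^{121}`), so the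
seat's reduction `HeathBrown2001_largestPrimeFactor_cubic_of_card_smoothLog_ge` (Lemma 2 =
`card_largePrime_eventually_ge`, file `…Chebyshev`) applies.  The threshold `10⁻⁹⁰` is far below
Heath-Brown's `S₀ ≥ 9.2 · 10⁻⁸` (p. 565); it is what the remaining sieve-theoretic input — his
§§4–8 given Theorem 2 — has to deliver, and it leaves room for crude explicit constants there.

## References

* D. R. Heath-Brown, *The largest prime factor of `X³ + 2`*, Proc. London Math. Soc. (3) 82 (2001)
  554–596: §2, Lemma 3 (p. 561), p. 560 (the sufficient condition), p. 562 (the remark), p. 565.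
  [`HeathBrown2001LargestPrimeFactorCubic`]
* A. J. Irving, *The largest prime factor of `X³ + 2`*, arXiv:1412.0024; Acta Arith. 171 (2015)
  67–80, §2 (the bound for `W`, the truncation at `H`) and Lemma 3.2.
  [`Irving2014LargestPrimeFactorCubic`]
-/

noncomputable section

open Filter Finset Real

namespace Literature.NumberTheory.Sieve.LargestPrimeFactorCubic

/-! ### Numerics of the tail `400 < h ≤ 963` -/

/-- For `401 ≤ h ≤ 963`, `k = [h/3]`: the argument `(3 − (k−1)δ)/((h−k+1)δ) = (964 − k)/(h − k + 1)`
of Irving's logarithm lies in `[1, 3.1]`. [cite: Irving2014LargestPrimeFactorCubic, Lemma 3.2] -/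
theorem ratio_mem {h : ℕ} (hh : 401 ≤ h) (hh' : h ≤ 963) :
    1 ≤ (3 - ((h / 3 - 1 : ℕ) : ℝ) * ((1 : ℝ) / 321)) / (((h - h / 3 + 1 : ℕ) : ℝ) * ((1 : ℝ) / 321)) ∧
    (3 - ((h / 3 - 1 : ℕ) : ℝ) * ((1 : ℝ) / 321)) / (((h - h / 3 + 1 : ℕ) : ℝ) * ((1 : ℝ) / 321))
      ≤ 31 / 10 := by
  have hk1 : ((h / 3 - 1 : ℕ) : ℝ) = (h / 3 : ℕ) - 1 := by
    have : 1 ≤ h / 3 := by omega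
    push_cast [Nat.cast_sub this]; ring
  have hk2 : ((h - h / 3 + 1 : ℕ) : ℝ) = (h : ℝ) - (h / 3 : ℕ) + 1 := by
    have : h / 3 ≤ h := Nat.div_le_self h 3
    push_cast [Nat.cast_sub this]; ring
  rw [hk1, hk2]
  have hden : (0 : ℝ) < ((h : ℝ) - (h / 3 : ℕ) + 1) * (1 / 321) := by
    have : ((h / 3 : ℕ) : ℝ) ≤ h := by exact_mod_cast Nat.div_le_self h 3
    nlinarith
  have hh1 : (401 : ℝ) ≤ h := by exact_mod_cast hh
  have hh2 : (h : ℝ) ≤ 963 := by exact_mod_cast hh'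
  have hk3 : (3 * (h / 3 : ℕ) : ℝ) ≤ h := by exact_mod_cast Nat.mul_div_le h 3
  have hk4 : (h : ℝ) ≤ 3 * (h / 3 : ℕ) + 2 := by
    have : h ≤ 3 * (h / 3) + 2 := by omega
    exact_mod_cast this
  constructor
  · rw [le_div_iff₀ hden]; nlinarith
  · rw [div_le_iff₀ hden]; nlinarith

/-- Hence `0 ≤ log((964 − k)/(h − k + 1)) ≤ 57/50` for `401 ≤ h ≤ 963` (`e^{57/50} > 3.1`).
[cite: Irving2014LargestPrimeFactorCubic, Lemma 3.2] -/
theorem log_ratio_mem {h : ℕ} (hh : 401 ≤ h) (hh' : h ≤ 963) :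
    0 ≤ Real.log ((3 - ((h / 3 - 1 : ℕ) : ℝ) * ((1 : ℝ) / 321)) /
        (((h - h / 3 + 1 : ℕ) : ℝ) * ((1 : ℝ) / 321))) ∧
    Real.log ((3 - ((h / 3 - 1 : ℕ) : ℝ) * ((1 : ℝ) / 321)) /
        (((h - h / 3 + 1 : ℕ) : ℝ) * ((1 : ℝ) / 321))) ≤ 57 / 50 := by
  obtain ⟨h1, h2⟩ := ratio_mem hh hh'
  refine ⟨Real.log_nonneg h1, ?_⟩
  have hpos : (0 : ℝ) < (3 - ((h / 3 - 1 : ℕ) : ℝ) * ((1 : ℝ) / 321)) /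
      (((h - h / 3 + 1 : ℕ) : ℝ) * ((1 : ℝ) / 321)) := lt_of_lt_of_le one_pos h1
  rw [Real.log_le_iff_le_exp hpos]
  refine h2.trans ?_
  -- `e^{57/50} ≥ e · (1 + 7/50 + (7/50)²/2) ≥ 2.718 · 1.1498 > 3.1`
  have he : Real.exp (57 / 50) = Real.exp 1 * Real.exp (7 / 50) := by
    rw [← Real.exp_add]; norm_num
  rw [he]
  have h3 : (1 : ℝ) + 7 / 50 + (7 / 50) ^ 2 / 2 ≤ Real.exp (7 / 50) :=
    Real.quadratic_le_exp_of_nonneg (by norm_num)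
  have h4 : (2.7182818283 : ℝ) < Real.exp 1 := Real.exp_one_gt_d9
  have h5 : 0 ≤ (Real.exp 1 - 2.7182818283) * (Real.exp (7 / 50) - (1 + 7 / 50 + (7 / 50) ^ 2 / 2)) :=
    mul_nonneg (by linarith) (by linarith)
  nlinarith [h5]

/-- `(228/25)^k/k!` is non-increasing from `k = 133` on (`228/25 < 134`). [folklore] -/
theorem pow_div_factorial_le {k : ℕ} (hk : 133 ≤ k) :
    ((228 : ℝ) / 25) ^ k / k.factorial ≤ ((228 : ℝ) / 25) ^ 133 / (Nat.factorial 133) := by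
  induction k, hk using Nat.le_induction with
  | base => exact le_rfl
  | succ k hk ih =>
      refine le_trans ?_ ih
      rw [pow_succ, Nat.factorial_succ, Nat.cast_mul, div_le_div_iff₀ (by positivity) (by positivity)]
      have hk' : (133 : ℝ) ≤ k := by exact_mod_cast hk
      have h0 : (0 : ℝ) ≤ ((228 : ℝ) / 25) ^ k := by positivity
      have h1 : (0 : ℝ) < (k.factorial : ℝ) := by positivity
      -- `x^k · (228/25) · k! ≤ x^k · ((k+1) · k!)`
      push_cast
      nlinarith [mul_nonneg h0 h1.le]

set_option exponentiation.threshold 1024 in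
/-- Each term of the tail is tiny: for `401 ≤ h ≤ 963`, `k = [h/3]`,
`min(h, 321) · 2^h · (57/50)^k/k! ≤ 1284 · (228/25)^{133}/133!` (`2^h ≤ 4 · 8^k`).
[cite: Irving2014LargestPrimeFactorCubic, §5 (numerics)] -/
theorem tail_term_le {h : ℕ} (hh : 401 ≤ h) (hh' : h ≤ 963) :
    ((min h 321 : ℕ) : ℝ) * 2 ^ h * (((57 : ℝ) / 50) ^ (h / 3) / (h / 3).factorial) ≤
      1284 * (((228 : ℝ) / 25) ^ 133 / (Nat.factorial 133)) := by
  have hk : 133 ≤ h / 3 := by omega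
  have hmin : ((min h 321 : ℕ) : ℝ) ≤ 321 := by exact_mod_cast min_le_right h 321
  have h2h : (2 : ℝ) ^ h ≤ 4 * 8 ^ (h / 3) := by
    have : 2 ^ h ≤ 4 * 8 ^ (h / 3) := by
      calc 2 ^ h ≤ 2 ^ (3 * (h / 3) + 2) := Nat.pow_le_pow_right (by norm_num) (by omega)
        _ = 4 * 8 ^ (h / 3) := by rw [pow_add, pow_mul]; norm_num; ring
    exact_mod_cast this
  have hmono := pow_div_factorial_le hk
  have e8 : ((228 : ℝ) / 25) ^ (h / 3) = 8 ^ (h / 3) * ((57 : ℝ) / 50) ^ (h / 3) := by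
    rw [← mul_pow]; norm_num
  rw [e8, mul_div_assoc] at hmono
  have hf : (0 : ℝ) < ((h / 3).factorial : ℝ) := by positivity
  have hq : 0 ≤ ((57 : ℝ) / 50) ^ (h / 3) / (h / 3).factorial := by positivity
  calc ((min h 321 : ℕ) : ℝ) * 2 ^ h * (((57 : ℝ) / 50) ^ (h / 3) / (h / 3).factorial)
      ≤ 321 * (4 * 8 ^ (h / 3)) * (((57 : ℝ) / 50) ^ (h / 3) / (h / 3).factorial) := by
        gcongr
    _ = 1284 * (8 ^ (h / 3) * (((57 : ℝ) / 50) ^ (h / 3) / (h / 3).factorial)) := by ring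
    _ ≤ 1284 * (((228 : ℝ) / 25) ^ 133 / (Nat.factorial 133)) :=
        mul_le_mul_of_nonneg_left hmono (by norm_num)

set_option exponentiation.threshold 1024 in
/-- **The numerical tail bound**: `∑_{400 < h ≤ 963} min(h,321) 2^h (57/50)^{[h/3]}/[h/3]! ≤ 10⁻⁹²`
(563 terms, each `≤ 1284 · (228/25)^{133}/133! < 1.7 · 10⁻⁹⁵`).
[cite: Irving2014LargestPrimeFactorCubic, §5 (numerics)] -/
theorem tail_numeric :
    ∑ h ∈ Ioc (400 : ℕ) 963, ((min h 321 : ℕ) : ℝ) * 2 ^ h *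
        (((57 : ℝ) / 50) ^ (h / 3) / (h / 3).factorial) ≤ 1 / 10 ^ 92 := by
  calc ∑ h ∈ Ioc (400 : ℕ) 963, ((min h 321 : ℕ) : ℝ) * 2 ^ h *
        (((57 : ℝ) / 50) ^ (h / 3) / (h / 3).factorial)
      ≤ ∑ _h ∈ Ioc (400 : ℕ) 963, (1284 : ℝ) * (((228 : ℝ) / 25) ^ 133 / (Nat.factorial 133)) := by
        refine sum_le_sum (fun h hh => ?_)
        rw [mem_Ioc] at hh
        exact tail_term_le (by omega) hh.2
    _ = 563 * ((1284 : ℝ) * (((228 : ℝ) / 25) ^ 133 / (Nat.factorial 133))) := by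
        rw [sum_const, Nat.card_Ioc, nsmul_eq_mul]; norm_num
    _ ≤ 1 / 10 ^ 92 := by
        norm_num [Nat.factorial]

/-! ### The tail `∑_{400 < h ≤ 963} min(h,321) 2^h T(h) ≤ 2 · 10⁻⁹² X` from Lemma 3.2 -/

set_option exponentiation.threshold 1024 in
open scoped Classical in
/-- **Irving's tail for `h > 400`** from his Lemma 3.2 (tree: `Irving2015.irving_lemma_3_2`) and
`tail_numeric`: for all large `X`,
`∑_{400 < h ≤ 963} min(h, 321) 2^h #{n ∈ (X,2X] : Ω(n) ≥ h} ≤ 2 · 10⁻⁹² X`.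
[cite: Irving2014LargestPrimeFactorCubic, Lemma 3.2 and §5] -/
theorem tail_le_eventually :
    ∀ᶠ X : ℕ in atTop,
      ∑ h ∈ Ioc (400 : ℕ) 963, ((min h 321 : ℕ) : ℝ) * 2 ^ h *
          (#((Ioc X (2 * X)).filter fun n : ℕ => h ≤
            ((Nat.primeFactorsList (n ^ 3 + 2)).filter
              (fun p => ⌈(X : ℝ) ^ ((1 : ℝ) / 321)⌉₊ ≤ p)).length) : ℝ) ≤
        2 / 10 ^ 92 * X := by
  set ε₀ : ℝ := (1 / 10 ^ 92) / (321 * 2 ^ 964) with hε₀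
  have hε₀pos : 0 < ε₀ := by rw [hε₀]; positivity
  have hev : ∀ h ∈ Ioc (400 : ℕ) 963, ∀ᶠ X : ℕ in atTop,
      (#((Ioc X (2 * X)).filter fun n : ℕ => h ≤
          ((Nat.primeFactorsList (n ^ 3 + 2)).filter
            (fun p => ⌈(X : ℝ) ^ ((1 : ℝ) / 321)⌉₊ ≤ p)).length) : ℝ) ≤
        ((Real.log ((3 - ((h / 3 - 1 : ℕ) : ℝ) * ((1 : ℝ) / 321)) /
            (((h - h / 3 + 1 : ℕ) : ℝ) * ((1 : ℝ) / 321)))) ^ (h / 3) / (h / 3).factorial + ε₀) *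
          X := by
    intro h hh
    rw [mem_Ioc] at hh
    refine Irving2015.irving_lemma_3_2 (by norm_num) (by norm_num) (by omega) ?_ hε₀pos
    have h1 : ((h - h / 3 + 1 : ℕ) : ℝ) + ((h / 3 - 1 : ℕ) : ℝ) = h := by
      have : (h - h / 3 + 1) + (h / 3 - 1) = h := by omega
      exact_mod_cast this
    have h2 : (h : ℝ) ≤ 963 := by exact_mod_cast hh.2
    nlinarith [h1, h2]
  rw [← Filter.eventually_all_finset] at hev
  filter_upwards [hev] with X hhigh
  have hX0 : (0 : ℝ) ≤ X := Nat.cast_nonneg X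
  -- replace `c(h, 1/321)` by `(57/50)^k/k!`
  have hc : ∀ h ∈ Ioc (400 : ℕ) 963,
      (Real.log ((3 - ((h / 3 - 1 : ℕ) : ℝ) * ((1 : ℝ) / 321)) /
          (((h - h / 3 + 1 : ℕ) : ℝ) * ((1 : ℝ) / 321)))) ^ (h / 3) / (h / 3).factorial ≤
        ((57 : ℝ) / 50) ^ (h / 3) / (h / 3).factorial := by
    intro h hh
    rw [mem_Ioc] at hh
    obtain ⟨h0, h1⟩ := log_ratio_mem (h := h) (by omega) hh.2
    exact div_le_div_of_nonneg_right (pow_le_pow_left₀ h0 h1 _) (by positivity)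
  calc ∑ h ∈ Ioc (400 : ℕ) 963, ((min h 321 : ℕ) : ℝ) * 2 ^ h *
        (#((Ioc X (2 * X)).filter fun n : ℕ => h ≤
          ((Nat.primeFactorsList (n ^ 3 + 2)).filter
            (fun p => ⌈(X : ℝ) ^ ((1 : ℝ) / 321)⌉₊ ≤ p)).length) : ℝ)
      ≤ ∑ h ∈ Ioc (400 : ℕ) 963, ((min h 321 : ℕ) : ℝ) * 2 ^ h *
          ((((57 : ℝ) / 50) ^ (h / 3) / (h / 3).factorial + ε₀) * X) := by
        refine sum_le_sum (fun h hh => ?_)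
        refine mul_le_mul_of_nonneg_left ((hhigh h hh).trans ?_) (by positivity)
        exact mul_le_mul_of_nonneg_right (by linarith [hc h hh]) hX0
    _ = (∑ h ∈ Ioc (400 : ℕ) 963, ((min h 321 : ℕ) : ℝ) * 2 ^ h *
            (((57 : ℝ) / 50) ^ (h / 3) / (h / 3).factorial)) * X +
          ε₀ * (∑ h ∈ Ioc (400 : ℕ) 963, ((min h 321 : ℕ) : ℝ) * 2 ^ h) * X := by
        rw [sum_mul, mul_sum, sum_mul, ← sum_add_distrib]
        refine sum_congr rfl (fun h _ => ?_)
        ring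
    _ ≤ (1 / 10 ^ 92) * X + ε₀ * (321 * 2 ^ 964) * X := by
        have hgeo : ∑ h ∈ Ioc (400 : ℕ) 963, ((min h 321 : ℕ) : ℝ) * 2 ^ h ≤ 321 * 2 ^ 964 := by
          calc ∑ h ∈ Ioc (400 : ℕ) 963, ((min h 321 : ℕ) : ℝ) * 2 ^ h
              ≤ ∑ h ∈ Ioc (400 : ℕ) 963, (321 : ℝ) * 2 ^ h := by
                refine sum_le_sum (fun h _ => ?_)
                have : ((min h 321 : ℕ) : ℝ) ≤ 321 := by exact_mod_cast min_le_right h 321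
                exact mul_le_mul_of_nonneg_right this (by positivity)
            _ = 321 * ∑ h ∈ Ioc (400 : ℕ) 963, (2 : ℝ) ^ h := by rw [mul_sum]
            _ ≤ 321 * ∑ h ∈ range 964, (2 : ℝ) ^ h := by
                refine mul_le_mul_of_nonneg_left ?_ (by norm_num)
                refine sum_le_sum_of_subset_of_nonneg (fun h hh => ?_) (fun _ _ _ => by positivity)
                rw [mem_Ioc] at hh; rw [mem_range]; omega
            _ ≤ 321 * 2 ^ 964 := by
                rw [geom_sum_eq (by norm_num : (2 : ℝ) ≠ 1)]
                norm_num
        gcongr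
        exact tail_numeric
    _ = 2 / 10 ^ 92 * X := by
        rw [hε₀]; field_simp; ring

/-! ### Theorem 1 from the weights -/

set_option exponentiation.threshold 1024 in
open scoped Classical in
/-- **Heath-Brown 2001, Theorem 1 from sieve weights** (his Lemma 3, p. 561, with Irving's
counting, Acta Arith. 171 (2015) §2 and Lemma 3.2, in place of the maximum `[δ⁻¹] 2^{[3/δ]}` of the
weight).  Let `Ω(n)` be the number of prime factors `p ≥ ⌈X^{1/321}⌉` of `n³ + 2` counted with
multiplicity.  Suppose that for all large `X` there are weights `W(n) ∈ ℕ`, `n ∈ (X, 2X]`, with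
(i) `W(n) > 0 ⇒ ∑_{p ≤ 3X} v_p(n³+2) log p ≥ (1 + 1/321) log X` (membership in `𝒜^{(1)}`),
(ii) `W(n) ≤ min(Ω(n), 321) · 2^{Ω(n)}`, and (iii) `∑_n W(n) ≥ c X` for a constant `c ≥ 10⁻⁹⁰`
(Heath-Brown: `W(n) = #{(K, L) : KL ∣ n + ∛2, (N(L), Q) = 1}`, `∑ W ≥ S = X S₀ + S₁`,
`S₀ ≥ 9.2 · 10⁻⁸`, `S₁ = o(X)`).  Then `HeathBrown2001_largestPrimeFactor_cubic` holds: with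
`H = 400`, `#{W > 0} ≥ (c − 2 · 10⁻⁹²) X/(321 · 2^{400}) = α X` (`Irving2015.sum_weight_le`,
`tail_le_eventually`) and `αδ/2 > 10⁻³⁰³`, so Lemma 2
(`HeathBrown2001_largestPrimeFactor_cubic_of_card_smoothLog_ge`) applies.
[cite: HeathBrown2001LargestPrimeFactorCubic, §2 Lemma 3 (p. 561) and p. 565]
[cite: Irving2014LargestPrimeFactorCubic, §2 and Lemma 3.2] -/
theorem HeathBrown2001_largestPrimeFactor_cubic_of_weights {c : ℝ} (hc : 1 / 10 ^ 90 ≤ c)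
    (hA : ∀ᶠ X : ℕ in atTop, ∃ W : ℕ → ℕ,
      c * (X : ℝ) ≤ ∑ n ∈ Ioc X (2 * X), (W n : ℝ) ∧
      (∀ n ∈ Ioc X (2 * X), 0 < W n → (1 + 1 / 321) * Real.log X ≤
        ∑ p ∈ Nat.primesLE (3 * X), ((n ^ 3 + 2).factorization p : ℝ) * Real.log p) ∧
      (∀ n ∈ Ioc X (2 * X), W n ≤
        min ((Nat.primeFactorsList (n ^ 3 + 2)).filter
            (fun p => ⌈(X : ℝ) ^ ((1 : ℝ) / 321)⌉₊ ≤ p)).length 321 *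
          2 ^ ((Nat.primeFactorsList (n ^ 3 + 2)).filter
            (fun p => ⌈(X : ℝ) ^ ((1 : ℝ) / 321)⌉₊ ≤ p)).length)) :
    HeathBrown2001_largestPrimeFactor_cubic := by
  -- the proportion of `n` with positive weight
  set α : ℝ := (c - 2 / 10 ^ 92) / (321 * 2 ^ 400) with hα
  have hcpos : 2 / 10 ^ 92 < c := lt_of_lt_of_le (by norm_num) hc
  have hαpos : 0 < α := by rw [hα]; exact div_pos (by linarith) (by positivity)
  have hδpos : (0 : ℝ) < 1 / 321 := by norm_num
  have hϖ : (1 : ℝ) / 10 ^ 303 < α * (1 / 321) / 2 := by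
    -- `α ≥ (10⁻⁹⁰ − 2·10⁻⁹²)/(321 · 2^400)` and `2^400 < 10^121`
    have h1 : (1 / 10 ^ 90 - 2 / 10 ^ 92) / (321 * 2 ^ 400) ≤ α := by
      rw [hα]; gcongr
    have h2 : (1 : ℝ) / 10 ^ 303 < (1 / 10 ^ 90 - 2 / 10 ^ 92) / (321 * 2 ^ 400) * (1 / 321) / 2 := by
      norm_num
    linarith
  refine HeathBrown2001_largestPrimeFactor_cubic_of_card_smoothLog_ge hαpos hδpos hϖ ?_
  -- `X` large: `X^{1/321} > 10`
  have hlarge : ∀ᶠ X : ℕ in atTop, (10 : ℝ) < (X : ℝ) ^ ((1 : ℝ) / 321) := by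
    have h10 : (10 : ℝ) = ((10 : ℝ) ^ (321 : ℕ)) ^ ((1 : ℝ) / 321) := by
      rw [← Real.rpow_natCast, ← Real.rpow_mul (by norm_num)]; norm_num
    filter_upwards [eventually_gt_atTop (10 ^ 321)] with X hX
    rw [h10]
    refine Real.rpow_lt_rpow (by positivity) ?_ (by norm_num)
    exact_mod_cast hX
  filter_upwards [hA, tail_le_eventually, hlarge, eventually_ge_atTop 1] with X hAX hBX hX10 hX1
  obtain ⟨W, hsum, hgood, hWle⟩ := hAX
  set S := Ioc X (2 * X) with hS
  set z : ℕ := ⌈(X : ℝ) ^ ((1 : ℝ) / 321)⌉₊ with hz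
  set Ω : ℕ → ℕ :=
    fun n => ((Nat.primeFactorsList (n ^ 3 + 2)).filter (fun p => z ≤ p)).length with hΩ
  have hXpos : (0 : ℝ) < X := by exact_mod_cast hX1
  -- `Ω(n) ≤ 963` on `S`
  have hΩle : ∀ n ∈ S, Ω n ≤ 963 := by
    intro n hn
    rw [hS, mem_Ioc] at hn
    have hzreal : (X : ℝ) ^ ((1 : ℝ) / 321) ≤ (z : ℝ) := Nat.le_ceil _
    have hz1 : 1 < z := by
      have : (10 : ℝ) < z := hX10.trans_le hzreal
      exact_mod_cast (show (1 : ℝ) < z by linarith)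
    have hm : n ^ 3 + 2 < z ^ 964 := by
      have h1 : ((n ^ 3 + 2 : ℕ) : ℝ) ≤ 10 * (X : ℝ) ^ 3 := by
        have : n ^ 3 + 2 ≤ 10 * X ^ 3 := by
          have h2 := Nat.pow_le_pow_left hn.2 3
          have hx3 : 1 ≤ X ^ 3 := Nat.one_le_pow _ _ hX1
          have e1 : (2 * X) ^ 3 = 8 * X ^ 3 := by ring
          rw [e1] at h2; generalize X ^ 3 = Y at h2 hx3 ⊢; omega
        exact_mod_cast this
      have h2 : 10 * (X : ℝ) ^ 3 < ((X : ℝ) ^ ((1 : ℝ) / 321)) ^ (964 : ℕ) := by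
        have e : ((X : ℝ) ^ ((1 : ℝ) / 321)) ^ (964 : ℕ) =
            (X : ℝ) ^ 3 * (X : ℝ) ^ ((1 : ℝ) / 321) := by
          rw [← Real.rpow_natCast, ← Real.rpow_mul hXpos.le]
          rw [show ((1 : ℝ) / 321 * ((964 : ℕ) : ℝ)) = (3 : ℕ) + (1 : ℝ) / 321 by norm_num,
            Real.rpow_add hXpos, Real.rpow_natCast]
        rw [e]
        have hX3 : (0 : ℝ) < (X : ℝ) ^ 3 := by positivity
        nlinarith
      have h3 : ((X : ℝ) ^ ((1 : ℝ) / 321)) ^ (964 : ℕ) ≤ (z : ℝ) ^ (964 : ℕ) :=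
        pow_le_pow_left₀ (by positivity) hzreal _
      exact_mod_cast (h1.trans_lt (h2.trans_le h3))
    have := Irving2015.card_largePrimeFactors_lt (m := n ^ 3 + 2) (by positivity) hz1 hm
    simpa [hΩ] using Nat.lt_succ_iff.1 this
  -- the truncation inequality with `H = 400`, `M = 321`, `B = 963`
  have hWle' : ∀ n ∈ S, W n ≤ min (Ω n) 321 * 2 ^ Ω n := fun n hn => hWle n hn
  have key := Irving2015.sum_weight_le S W Ω 321 400 963 hWle' hΩle
  have keyR : (∑ n ∈ S, (W n : ℝ)) ≤
      ((min 400 321 : ℕ) : ℝ) * 2 ^ 400 * (#(S.filter fun n => 0 < W n) : ℝ) +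
        ∑ h ∈ Ioc (400 : ℕ) 963, ((min h 321 : ℕ) : ℝ) * 2 ^ h *
          (#(S.filter fun n : ℕ => h ≤ Ω n) : ℝ) := by
    have := (Nat.cast_le (α := ℝ)).2 key
    simpa only [Nat.cast_sum, Nat.cast_add, Nat.cast_mul, Nat.cast_pow, Nat.cast_ofNat] using this
  have hBX' : ∑ h ∈ Ioc (400 : ℕ) 963, ((min h 321 : ℕ) : ℝ) * 2 ^ h *
      (#(S.filter fun n : ℕ => h ≤ Ω n) : ℝ) ≤ 2 / 10 ^ 92 * X := hBX
  -- hence `α X ≤ #{W > 0} ≤ #{good n}`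
  have hpos : α * X ≤ (#(S.filter fun n => 0 < W n) : ℝ) := by
    have hmin : ((min 400 321 : ℕ) : ℝ) = 321 := by norm_num
    rw [hmin] at keyR
    rw [hα]
    have h2 : (0 : ℝ) < 321 * 2 ^ 400 := by positivity
    have h3 : (c - 2 / 10 ^ 92) * (X : ℝ) ≤ 321 * 2 ^ 400 * (#(S.filter fun n => 0 < W n) : ℝ) := by
      nlinarith
    calc (c - 2 / 10 ^ 92) / (321 * 2 ^ 400) * (X : ℝ)
        = ((c - 2 / 10 ^ 92) * (X : ℝ)) / (321 * 2 ^ 400) := by ring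
      _ ≤ (#(S.filter fun n => 0 < W n) : ℝ) := by rw [div_le_iff₀ h2]; linarith
  refine hpos.trans ?_
  exact_mod_cast card_le_card (fun n hn => by
    rw [mem_filter] at hn ⊢
    exact ⟨hn.1, hgood n hn.1 hn.2⟩)

open scoped Classical in
/-- **Heath-Brown 2001, Theorem 1 from sieve weights, divisor form** — the same with (i) replaced
by his sufficient condition (p. 560): every `n` of positive weight admits a divisor `d ∣ n³ + 2`
with `d > X^{1+1/321}` all of whose prime factors are `≤ 3X` (for him `d = N(KL)`,
`X^{1+δ} < N(KL) ≤ X^{1+2δ}`, `N(K) ≤ X^{4δ}`, `N(L) ≤ X^{1−δ}`, so that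
`log^{(1)}(n³+2) ≥ log N(KL) ≥ (1+δ) log X`).
[cite: HeathBrown2001LargestPrimeFactorCubic, §2 p. 560 and Lemma 3] -/
theorem HeathBrown2001_largestPrimeFactor_cubic_of_divisorWeights {c : ℝ} (hc : 1 / 10 ^ 90 ≤ c)
    (hA : ∀ᶠ X : ℕ in atTop, ∃ W : ℕ → ℕ,
      c * (X : ℝ) ≤ ∑ n ∈ Ioc X (2 * X), (W n : ℝ) ∧
      (∀ n ∈ Ioc X (2 * X), 0 < W n → ∃ d : ℕ, d ∣ n ^ 3 + 2 ∧
        (X : ℝ) ^ (1 + (1 : ℝ) / 321) < d ∧ ∀ p : ℕ, p.Prime → p ∣ d → p ≤ 3 * X) ∧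
      (∀ n ∈ Ioc X (2 * X), W n ≤
        min ((Nat.primeFactorsList (n ^ 3 + 2)).filter
            (fun p => ⌈(X : ℝ) ^ ((1 : ℝ) / 321)⌉₊ ≤ p)).length 321 *
          2 ^ ((Nat.primeFactorsList (n ^ 3 + 2)).filter
            (fun p => ⌈(X : ℝ) ^ ((1 : ℝ) / 321)⌉₊ ≤ p)).length)) :
    HeathBrown2001_largestPrimeFactor_cubic := by
  refine HeathBrown2001_largestPrimeFactor_cubic_of_weights hc ?_
  filter_upwards [hA] with X hX
  obtain ⟨W, hsum, hgood, hWle⟩ := hX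
  refine ⟨W, hsum, fun n hn hW => ?_, hWle⟩
  obtain ⟨d, hd, hXd, hsmooth⟩ := hgood n hn hW
  have hX0 : (0 : ℝ) < X := by
    have : 0 < X := by rw [mem_Ioc] at hn; omega
    exact_mod_cast this
  calc (1 + 1 / 321) * Real.log X = Real.log ((X : ℝ) ^ (1 + (1 : ℝ) / 321)) :=
        (Real.log_rpow hX0 _).symm
    _ ≤ Real.log d := Real.log_le_log (by positivity) hXd.le
    _ ≤ _ := log_le_smoothLog_of_dvd hd hsmooth

end Literature.NumberTheory.Sieve.LargestPrimeFactorCubic
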